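import Summits.MatrixMultiplication.MatrixMultiplication.Theorems.ObstructionDescentKernelUpper
import Summits.MatrixMultiplication.MatrixMultiplication.Theorems.ObstructionDescentMatMulBlowUp
import Literature.NumberTheory.DiophantineGeometry.SymmetricGroupCharacterProjectors

set_option linter.dupNamespace false
set_option autoImplicit false

/-!
# Obstruction descent — a non-singular blow-up meets the two-rectangular sector: `D_X(t) ≠ 0` for some
# `X ∈ Mat_δ^N` forces SOME `((δ^N),(δ^N),ν) ∈ S(t)`; matrix multiplication `⟨n,n,n⟩` at every height `δ`
# (decomp-mm · lens 3 · gen 47, part 3; def-free)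

`route-MatrixMultiplication-ObstructionDescent`, SUPPORT for the crux `NoOccurrenceObstruction` (`P_O`, stmt 29040); NODE-g47 §3
(the (NC) entry of the dictionary).  Currency as in parts 1–2 (`…KernelPolarisation`, `…KernelUpper`).

CONTENT.  §1 the ISOTYPIC RESOLUTION of a 3-leg array in leg 3, `Σ_ν (f^ν/n!) · isotypicSum₃ ν T = T` (tree
`sum_smul_charSum_eq_id` for the place-permutation representation `wordPermRep`, slice by slice), and its pairing form:
`⟪T, K⟫ ≠ 0 ⟹ ∃ ν, ⟪isotypicSum₃ ν T, K⟫ ≠ 0`.  §2 with part 2's upper direction: if the blow-up determinant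
`D_X(t) = det(Σ_l X_l ⊗ t_{••l}) = ⟪t^{⊗Nδ}, K_X⟫` is non-zero for ONE tuple `X ∈ Mat_δ^N`, then the two-rectangular sector of
height `δ` of the support semigroup is NON-EMPTY: `∃ ν ⊢ Nδ, ((δ^N),(δ^N),ν) ∈ S(t)` (`exists_occurs_twoRectangle_of_blowUp_det_ne_zero`),
and the triple is inherited by `⟨m⟩`, `m ≥ max(N, bR(t))`.  In the language of matrix spaces: the `δ`-th BLOW-UP `{Σ_l X_l ⊗ T_l}`
of the slice space of `t` contains a non-singular matrix (which happens for some `δ ≤ N − 1` iff the slice space has full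
non-commutative rank — Ivanyos–Qiao–Subrahmanyam, Derksen–Makam; recorded in the memo, not used here).  §3 MATRIX
MULTIPLICATION: for `⟨n,n,n⟩` in its cubic format `N = n²` the blow-up at the block-identity tuple is `1` (part
`…MatMulBlowUp`, `det_kroneckerSum_slice_matMulTensor_blockOne`), so for EVERY `δ ≥ 1` (and `δ = 0` trivially) some
`((δ^{n²}),(δ^{n²}),ν)`, `ν ⊢ δn²`, occurs in `⟨n,n,n⟩^{⊗δn²}` (`exists_occurs_twoRectangle_matMulTensor`).
No definition is introduced; sorry-free; nothing here proves `ω = 2` or closes an item.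
[cite: BurgisserIkenmeyer2011, §3.1, §10.1] [cite: FultonHarrisGTM129, §2.4 Prop. 2.32] [cite: Blaser2013, §5]
[cite: ChristandlVranaZuiddam2023, §3.1]
-/

noncomputable section

open scoped BigOperators Matrix Kronecker

namespace Summit.MatrixMultiplication.MatrixMultiplication.Theorems.ObstructionDescentBlowUpNonEmpty

open Literature.Computability.AlgebraicComplexity
open Literature.NumberTheory.DiophantineGeometry
open Summit.MatrixMultiplication.MatrixMultiplication.Theorems.ObstructionDescentKernelUpper
open Summit.MatrixMultiplication.MatrixMultiplication.Theorems.ObstructionDescentBlowUpDuality (blowUp_det_eq_pairing_evalKernel)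
open Summit.MatrixMultiplication.MatrixMultiplication.Theorems.ObstructionDescentMatMulBlowUp
  (det_kroneckerSum_slice_matMulTensor_blockOne)
open Summit.MatrixMultiplication.MatrixMultiplication.Theorems.ObstructionCalculus (occurs_unitTensor_of_algBorderRank_le)

variable {N : ℕ}

/-! ### §1 Isotypic resolution in leg 3 and its pairing form -/

/-- `Σ_ν (f^ν/n!) · isotypicSum₃ ν T = T`: the isotypic decomposition of the leg-3 place-permutation action, slice by slice
(`sum_smul_charSum_eq_id` for `wordPermRep`). [cite: FultonHarrisGTM129, §2.4 Prop. 2.32] -/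
theorem sum_smul_isotypicSum₃_eq {n : ℕ} {ι κ : Type*} (T : (Fin n → ι) → (Fin n → κ) → Word N n → ℂ) :
    ∑ ν : Nat.Partition n, ((numStandardTableaux ν : ℂ) / (n.factorial : ℂ)) • isotypicSum₃ ν T = T := by
  classical
  funext u v w
  have h := congrArg (fun L : Module.End ℂ (Word N n → ℂ) => L (T u v) w)
    (sum_smul_charSum_eq_id (k := ℂ) (wordPermRep ℂ N n))
  simp only [LinearMap.sum_apply, LinearMap.smul_apply, Finset.sum_apply, Pi.smul_apply, wordPermRep_apply,
    wordPerm_apply, LinearMap.id_apply, smul_eq_mul] at h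
  simp only [Finset.sum_apply, Pi.smul_apply, smul_eq_mul, isotypicSum₃, permLegs₃_apply]
  exact h

/-- Pairing form: `⟪T, K⟫ = Σ_ν (f^ν/n!) ⟪isotypicSum₃ ν T, K⟫`. [folklore] -/
theorem pairing_eq_sum_pairing_isotypicSum₃ {n : ℕ} {ι κ : Type*} [Fintype ι] [Fintype κ]
    (T K : (Fin n → ι) → (Fin n → κ) → Word N n → ℂ) :
    ∑ u : Fin n → ι, ∑ v : Fin n → κ, ∑ w : Word N n, T u v w * K u v w =
      ∑ ν : Nat.Partition n, ((numStandardTableaux ν : ℂ) / (n.factorial : ℂ)) *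
        ∑ u : Fin n → ι, ∑ v : Fin n → κ, ∑ w : Word N n, isotypicSum₃ ν T u v w * K u v w := by
  classical
  conv_lhs => rw [← sum_smul_isotypicSum₃_eq T]
  simp only [Finset.sum_apply, Pi.smul_apply, smul_eq_mul, Finset.sum_mul, Finset.mul_sum]
  have h1 : ∀ (u : Fin n → ι) (v : Fin n → κ), ∑ w : Word N n, ∑ ν : Nat.Partition n,
      (numStandardTableaux ν : ℂ) / (n.factorial : ℂ) * isotypicSum₃ ν T u v w * K u v w =
      ∑ ν : Nat.Partition n, ∑ w : Word N n,
        (numStandardTableaux ν : ℂ) / (n.factorial : ℂ) * isotypicSum₃ ν T u v w * K u v w := fun u v => Finset.sum_comm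
  have h2 : ∀ (u : Fin n → ι), ∑ v : Fin n → κ, ∑ ν : Nat.Partition n, ∑ w : Word N n,
      (numStandardTableaux ν : ℂ) / (n.factorial : ℂ) * isotypicSum₃ ν T u v w * K u v w =
      ∑ ν : Nat.Partition n, ∑ v : Fin n → κ, ∑ w : Word N n,
        (numStandardTableaux ν : ℂ) / (n.factorial : ℂ) * isotypicSum₃ ν T u v w * K u v w := fun u => Finset.sum_comm
  have h3 : ∑ u : Fin n → ι, ∑ ν : Nat.Partition n, ∑ v : Fin n → κ, ∑ w : Word N n,
      (numStandardTableaux ν : ℂ) / (n.factorial : ℂ) * isotypicSum₃ ν T u v w * K u v w =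
      ∑ ν : Nat.Partition n, ∑ u : Fin n → ι, ∑ v : Fin n → κ, ∑ w : Word N n,
        (numStandardTableaux ν : ℂ) / (n.factorial : ℂ) * isotypicSum₃ ν T u v w * K u v w := Finset.sum_comm
  simp_rw [h1, h2]
  rw [h3]
  refine Finset.sum_congr rfl fun ν _ => Finset.sum_congr rfl fun u _ => Finset.sum_congr rfl fun v _ =>
    Finset.sum_congr rfl fun w _ => ?_
  ring

/-- `⟪T, K⟫ ≠ 0 ⟹ ∃ ν, ⟪isotypicSum₃ ν T, K⟫ ≠ 0`. [folklore] -/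
theorem exists_pairing_isotypicSum₃_ne_zero {n : ℕ} {ι κ : Type*} [Fintype ι] [Fintype κ]
    (T K : (Fin n → ι) → (Fin n → κ) → Word N n → ℂ)
    (h : ∑ u : Fin n → ι, ∑ v : Fin n → κ, ∑ w : Word N n, T u v w * K u v w ≠ 0) :
    ∃ ν : Nat.Partition n, ∑ u : Fin n → ι, ∑ v : Fin n → κ, ∑ w : Word N n, isotypicSum₃ ν T u v w * K u v w ≠ 0 := by
  by_contra hall
  push Not at hall
  apply h
  rw [pairing_eq_sum_pairing_isotypicSum₃]
  simp [hall]

/-! ### §2 A non-singular blow-up meets the two-rectangular sector -/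

section BlowUp

variable {δ : ℕ}

/-- **(NC), upper direction.**  If `D_X(t) = det(Σ_l X_l ⊗ t_{••l}) ≠ 0` for one tuple `X ∈ Mat_δ^N`, then SOME two-rectangular
triple of height `δ` occurs in `t^{⊗Nδ}`: `∃ ν ⊢ Nδ, isotypicSum₁ (δ^N) (isotypicSum₂ (δ^N) (isotypicSum₃ ν (t^{⊗Nδ}))) ≠ 0`.
[this node; cite: BurgisserIkenmeyer2011, §3.1] -/
theorem exists_occurs_twoRectangle_of_blowUp_det_ne_zero (e : Fin (N * δ) ≃ Fin δ × Fin N)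
    (X : Fin N → Matrix (Fin δ) (Fin δ) ℂ) (t : Fin N → Fin N → Fin N → ℂ)
    (h : (∑ l, X l ⊗ₖ Matrix.of (fun i j => t i j l)).det ≠ 0) :
    ∃ ν : Nat.Partition (N * δ), isotypicSum₁ (Nat.Partition.rectangle N δ)
      (isotypicSum₂ (Nat.Partition.rectangle N δ) (isotypicSum₃ ν (kroneckerPow t (N * δ)))) ≠ 0 := by
  classical
  rw [blowUp_det_eq_pairing_evalKernel e X t] at h
  obtain ⟨ν, hν⟩ := exists_pairing_isotypicSum₃_ne_zero _ _ h
  exact ⟨ν, isotypicSum₁₂₃_kroneckerPow_ne_zero_of_pairing_isotypicSum₃_ne_zero _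
    (fun A t' => pairing_blowUpKernel_actTensor₁ e X A t') (fun B t' => pairing_blowUpKernel_actTensor₂ e X B t') ν t hν⟩

/-- Inheritance: under the same hypothesis some `((δ^N),(δ^N),ν)` occurs in `⟨m⟩^{⊗Nδ}` for every `m ≥ N` with `bR(t) ≤ m`.
[this node; cite: BurgisserIkenmeyer2011, Lemma 10.18] -/
theorem exists_occurs_unitTensor_twoRectangle_of_blowUp_det_ne_zero {m : ℕ} (hNm : N ≤ m)
    (e : Fin (N * δ) ≃ Fin δ × Fin N) (X : Fin N → Matrix (Fin δ) (Fin δ) ℂ) (t : Fin N → Fin N → Fin N → ℂ)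
    (hbr : algBorderRank t ≤ m) (h : (∑ l, X l ⊗ₖ Matrix.of (fun i j => t i j l)).det ≠ 0) :
    ∃ ν : Nat.Partition (N * δ), isotypicSum₁ (Nat.Partition.rectangle N δ)
      (isotypicSum₂ (Nat.Partition.rectangle N δ) (isotypicSum₃ ν (kroneckerPow (unitTensor ℂ m) (N * δ)))) ≠ 0 := by
  obtain ⟨ν, hν⟩ := exists_occurs_twoRectangle_of_blowUp_det_ne_zero e X t h
  have := occurs_unitTensor_of_algBorderRank_le hNm t hbr (N * δ)
    ![Nat.Partition.rectangle N δ, Nat.Partition.rectangle N δ, ν] (by simpa using hν)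
  exact ⟨ν, by simpa using this⟩

end BlowUp

/-! ### §3 Matrix multiplication: the two-rectangular sector of `S(⟨n,n,n⟩)` is met at every height `δ` -/

/-- Relabelling all three legs of a tensor and the slot index of the tuple along one equivalence `f` reindexes the
blow-up matrix (hence preserves its determinant). [bookkeeping] -/
theorem kroneckerSum_slice_relabel {R : Type*} [CommRing R] {α β : Type*} [Fintype α] [Fintype β] [DecidableEq α]
    [DecidableEq β] {δ : ℕ} (f : α ≃ β) (X : β → Matrix (Fin δ) (Fin δ) R) (t : β → β → β → R) :
    (∑ l' : α, X (f l') ⊗ₖ Matrix.of (fun i j : α => t (f i) (f j) (f l'))) =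
      Matrix.reindex ((Equiv.refl (Fin δ)).prodCongr f.symm) ((Equiv.refl (Fin δ)).prodCongr f.symm)
        (∑ l : β, X l ⊗ₖ Matrix.of (fun i j : β => t i j l)) := by
  ext ⟨a, i⟩ ⟨b, j⟩
  simp only [Matrix.sum_apply, Matrix.kroneckerMap_apply, Matrix.of_apply, Matrix.reindex_apply, Matrix.submatrix_apply,
    Equiv.prodCongr_symm, Equiv.refl_symm, Equiv.prodCongr_apply, Equiv.coe_refl, Prod.map_apply, id_eq,
    Equiv.symm_symm]
  exact Equiv.sum_comp f (fun l => X l a b * t (f i) (f j) l)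

/-- **`⟨n,n,n⟩` meets every two-rectangular height.**  In the cubic format `N = n²` (legs relabelled along
`finProdFinEquiv`), for every `δ` some `((δ^{n²}),(δ^{n²}),ν)`, `ν ⊢ n²δ`, occurs in `⟨n,n,n⟩^{⊗n²δ}` — the blow-up determinant
at the block-identity tuple is `1`. [this node; cite: Blaser2013, §5; BurgisserIkenmeyer2011, §3.1] -/
theorem exists_occurs_twoRectangle_matMulTensor (n δ : ℕ) :
    ∃ ν : Nat.Partition (n * n * δ), isotypicSum₁ (Nat.Partition.rectangle (n * n) δ)
      (isotypicSum₂ (Nat.Partition.rectangle (n * n) δ) (isotypicSum₃ ν (kroneckerPow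
        (fun i j l : Fin (n * n) => matMulTensor ℂ n n n (finProdFinEquiv.symm i) (finProdFinEquiv.symm j)
          (finProdFinEquiv.symm l)) (n * n * δ)))) ≠ 0 := by
  classical
  refine exists_occurs_twoRectangle_of_blowUp_det_ne_zero
    ((finProdFinEquiv (m := n * n) (n := δ)).symm.trans (Equiv.prodComm (Fin (n * n)) (Fin δ)))
    (fun l' => if (finProdFinEquiv.symm l').1 = (finProdFinEquiv.symm l').2 then (1 : Matrix (Fin δ) (Fin δ) ℂ) else 0)
    _ ?_
  rw [kroneckerSum_slice_relabel (finProdFinEquiv (m := n) (n := n)).symm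
    (fun l : Fin n × Fin n => if l.1 = l.2 then (1 : Matrix (Fin δ) (Fin δ) ℂ) else 0) (matMulTensor ℂ n n n),
    Matrix.det_reindex_self, det_kroneckerSum_slice_matMulTensor_blockOne]
  exact one_ne_zero

end Summit.MatrixMultiplication.MatrixMultiplication.Theorems.ObstructionDescentBlowUpNonEmpty
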